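import Literature.Barriers.SmoothPoincare4.ExoticOpenFourSpacePolarProofs
import HarnessLib

/-!
# `deMichelisFreedman1992_continuum`: the discharge reduced to the §4 no-go in its weakest printed form — no diffeomorphism `R⁴_s ≅ R⁴_t`, `s < t ∈ CS`, is the identity NEAR `K`

Proof file (theorems only; sibling of `ExoticOpenFourSpaceProofs`, `ExoticOpenFourSpaceEmbeddingProofs`,
`ExoticOpenFourSpacePolarProofs`) for the named fact
`Literature.Barriers.SmoothPoincare4.deMichelisFreedman1992_continuum` (DeMichelis–Freedman 1992,
Thm. 4.1 with Cor. 4.1: continuum many pairwise non-diffeomorphic open subsets of standard `ℝ⁴`,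
each homeomorphic to `ℝ⁴`).

The siblings prove the elementary steps of the printed proofs that bear on this fact — Cor. 4.1's
ZFC count, the second and third paragraphs of the proof of Thm. 4.1 (p. 247), and the shape of the
polar family `R⁴_t` (open, nested, homeomorphic to `ℝ⁴`, `K ⊂ R⁴_0`); NOT rendered, and not
entering Cor. 4.1, are the assertions of Thm. 4.1 that the balls `R⁴_t`, `t ∈ CS`, are "ribbon
`ℝ⁴`'s" in the sense of §3 and that `ρ|[0, r]` extends to a topological polar coordinate on all
of `ℝ⁴` (Schoenflies, p. 248) — and reduce the discharge `deMichelisFreedman1992_continuum_holds`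
to the gauge-theoretic first paragraph of the proof of Thm. 4.1 for the printed polar family
(`deMichelisFreedman1992_continuum_of_polar_nogo`), with the no-go in the form printed on p. 247:
for `s ≠ t ∈ CS`, no diffeomorphism `d : R⁴_s → R⁴_t` "restricted to `K` is the identity".

THIS FILE weakens that remaining hypothesis to the form in which the source actually USES it
(§0, p. 220: "Suppose two pairs `(R⁴_s, K)`, `(R⁴_t, K)`, `s < t`, are diffeomorphic relative to
the identity on `K`, `(d, id_K)` …"; p. 247: "As in the introduction, this allows the
construction of end periodic metrics: `B_∞` isometric to `Q_∞`. This leads via Theorem 2.1 to a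
contradiction"), and slightly beyond:

* ORDERED: only parameters `s < t` need be considered (`nhdNogo_of_lt`: a diffeomorphism which
  is the identity near `K` has an inverse which is the identity near `K`);
* NEIGHBOURHOOD form: it suffices that no diffeomorphism `R⁴_s ≅ R⁴_t` restricts to the
  identity on an OPEN NEIGHBOURHOOD of `K` — a weaker demand on the gauge theory than "not the
  identity on `K`" (`polarNhdNogo_of_polarNogo` records the implication): the contradiction of
  §0/§4 need only be derived from a diffeomorphism that is the identity on a whole neighbourhood
  of `K` (in particular on `K`, so the printed argument — `⋂ₙ dⁿ(R⁴_t) ⊇ K`, end-periodic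
  metrics `B_n`, `Q_n`, `B_∞` isometric to `Q_∞`, `Φ(B) = Φ(B_∞) = Φ(Q_∞) = Φ(Q)` — applies
  verbatim).

That the weaker form suffices is the neighbourhood form of the second paragraph, proved in
`ExoticOpenFourSpaceEmbeddingProofs` (`exists_ne_diffeomorph_eqOn_nhd_of_not_countable`: among
uncountably many diffeomorphisms `φ_i : U_i ≅ M`, `K ⊆ U_i`, two differ by an ambient
diffeomorphism `h` of `M` with `h ∘ φ_i = φ_j` on an open neighbourhood of `K`, whence
`φ_j⁻¹ ∘ h ∘ φ_i : U_i ≅ U_j` is the identity near `K`).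

Results (all PROVED; no named fact is introduced):
* `countable_setOf_nonempty_diffeomorph_of_nhdNogo` — the combination step (third paragraph,
  p. 247) from the neighbourhood no-go, for any family of open subsets of `ℝ⁴` containing a
  compact `K`;
* `nhdNogo_of_lt` — for a linearly ordered parameter set the neighbourhood no-go for `s < t`
  gives it for `s ≠ t`;
* `polarNhdNogo_of_polarNogo` — the tree's (p. 247, on-`K`, `s ≠ t`) polar no-go implies the
  neighbourhood (`s < t`) one;
* `deMichelisFreedman1992_countableClasses_of_polar_nhdNogo` (Thm. 4.1: the `CS`-indexed nested
  family of open `ℝ⁴`-homeomorphs with countable diffeomorphism classes),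
  `deMichelisFreedman1992_continuum_of_polar_nhdNogo` (the tree's fact, via Cor. 4.1) and
  `openAnalogueBarrierFour_of_polar_nhdNogo` (the barrier) from the neighbourhood no-go for the
  polar family `polarBall R e t`, `t ∈ CS`, of ONE open `ℝ⁴`-homeomorph `R ⊆ ℝ⁴` with polar
  coordinates `e : R ≃ₜ ℝ⁴` and a compactum `K ⊂ R⁴_0`.

What remains undischarged is unchanged in nature — Kotschick's `Φ`-invariant, Taubes'
end-periodic theory (Thm. 2.1, App. A, B) and Freedman's structure theorem with the ribbon polar
coordinates (Thms. 3.1, 3.2) — but is now asked for in the weakest form the printed argument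
supports.

## References

* S. DeMichelis, M. H. Freedman, *Uncountably many exotic `R⁴`'s in standard 4-space*,
  J. Differential Geom. 35 (1992) 219–254: §0 (p. 220), Thm. 4.1 (p. 246), proof of Thm. 4.1
  (p. 247), Cor. 4.1 (pp. 247–248) [DeMichelisFreedman1992].

[DeMichelisFreedman1992]
-/

noncomputable section

open scoped Manifold ContDiff Topology
open TopologicalSpace Set

namespace Literature.Barriers.SmoothPoincare4

/-! ### The combination step from the neighbourhood no-go -/

/-- **Third paragraph of the proof of Thm. 4.1 from the NEIGHBOURHOOD no-go.** Let `R` be a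
family of open subsets of `ℝ⁴` each containing the compact set `K`. If for `s ≠ t` no
diffeomorphism `R s ≅ R t` restricts to the identity on an open neighbourhood of `K`, then only
countably many `R t` are diffeomorphic to a given `R s`: otherwise
(`exists_ne_diffeomorph_eqOn_nhd_of_not_countable`) two of uncountably many diffeomorphisms
`φ_t : R t ≅ R s` satisfy `h ∘ φ_a = φ_b` on an open `W ⊇ K` for a self-diffeomorphism `h` of
`R s`, and `φ_b⁻¹ ∘ h ∘ φ_a : R a ≅ R b` is the identity on `W`.
[cite: DeMichelisFreedman1992, proof of Thm. 4.1, p. 247 ("Combining the previous two paragraphs")] -/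
theorem countable_setOf_nonempty_diffeomorph_of_nhdNogo {ι : Type*}
    (R : ι → Opens (EuclideanSpace ℝ (Fin 4))) {K : Set (EuclideanSpace ℝ (Fin 4))}
    (hK : IsCompact K) (hKR : ∀ t, K ⊆ R t)
    (hno : ∀ s t, s ≠ t → ∀ d : R s ≃ₘ⟮𝓡 4, 𝓡 4⟯ R t, ∀ W : Set (EuclideanSpace ℝ (Fin 4)),
      IsOpen W → K ⊆ W →
        ∃ x : R s, (x : EuclideanSpace ℝ (Fin 4)) ∈ W ∧
          ((d x : R t) : EuclideanSpace ℝ (Fin 4)) ≠ x)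
    (s : ι) : {t | Nonempty (R t ≃ₘ⟮𝓡 4, 𝓡 4⟯ R s)}.Countable := by
  by_contra hT
  set T : Set ι := {t | Nonempty (R t ≃ₘ⟮𝓡 4, 𝓡 4⟯ R s)} with hTdef
  have hT' : ¬ Countable T := by rwa [Set.countable_coe_iff]
  let φ : ∀ t : T, R (t : ι) ≃ₘ⟮𝓡 4, 𝓡 4⟯ R s := fun t => Classical.choice t.2
  obtain ⟨a, b, hab, h, W, hWo, hKW, -, hWb, hh⟩ :=
    exists_ne_diffeomorph_eqOn_nhd_of_not_countable (R s) hK (fun t : T => R (t : ι)) φ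
      (fun t => hKR t) hT'
  have hab' : (a : ι) ≠ b := fun e => hab (Subtype.ext e)
  obtain ⟨x, hxW, hx⟩ := hno a b hab' ((φ a).trans (h.trans (φ b).symm)) W hWo hKW
  apply hx
  have hb : (x : EuclideanSpace ℝ (Fin 4)) ∈ R (b : ι) := hWb hxW
  have h1 : h (φ a x) = φ b ⟨x, hb⟩ := Subtype.ext (hh x x.2 hb hxW)
  simp only [Diffeomorph.coe_trans, Function.comp_apply, h1, Diffeomorph.symm_apply_apply]

/-! ### Ordered parameters suffice -/

/-- **Only `s < t` matters.** For a linearly ordered parameter set, if for `s < t` no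
diffeomorphism `R s ≅ R t` is the identity on a neighbourhood of `K` (`K ⊆ R t` for all `t`),
then the same holds for all `s ≠ t`: a diffeomorphism `d : R s ≅ R t` which is the identity on
`W ∩ R s`, `W ⊇ K` open, has inverse `d⁻¹` equal to the identity on the open neighbourhood
`W ∩ R s` of `K`. (§0 of the source orders the pair: "`(R⁴_s, K)`, `(R⁴_t, K)`, `s < t`".)
[cite: DeMichelisFreedman1992, §0 (p. 220)] -/
theorem nhdNogo_of_lt {ι : Type*} [LinearOrder ι]
    (R : ι → Opens (EuclideanSpace ℝ (Fin 4))) {K : Set (EuclideanSpace ℝ (Fin 4))}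
    (hKR : ∀ t, K ⊆ R t)
    (hno : ∀ s t, s < t → ∀ d : R s ≃ₘ⟮𝓡 4, 𝓡 4⟯ R t, ∀ W : Set (EuclideanSpace ℝ (Fin 4)),
      IsOpen W → K ⊆ W →
        ∃ x : R s, (x : EuclideanSpace ℝ (Fin 4)) ∈ W ∧
          ((d x : R t) : EuclideanSpace ℝ (Fin 4)) ≠ x) :
    ∀ s t, s ≠ t → ∀ d : R s ≃ₘ⟮𝓡 4, 𝓡 4⟯ R t, ∀ W : Set (EuclideanSpace ℝ (Fin 4)),
      IsOpen W → K ⊆ W →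
        ∃ x : R s, (x : EuclideanSpace ℝ (Fin 4)) ∈ W ∧
          ((d x : R t) : EuclideanSpace ℝ (Fin 4)) ≠ x := by
  intro s t hst d W hW hKW
  rcases lt_or_gt_of_ne hst with hlt | hgt
  · exact hno s t hlt d W hW hKW
  · by_contra hall
    push Not at hall
    obtain ⟨y, hyW, hy⟩ := hno t s hgt d.symm (W ∩ (R s : Set (EuclideanSpace ℝ (Fin 4))))
      (hW.inter (R s).isOpen) (subset_inter hKW (hKR s))
    apply hy
    set y' : R s := ⟨y, hyW.2⟩ with hy'
    have h1 : d y' = y := Subtype.ext (hall y' hyW.1)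
    have h2 : d.symm y = y' := by rw [← h1, Diffeomorph.symm_apply_apply]
    rw [h2]

/-! ### The polar family: Thm. 4.1, the tree's fact and the barrier from the neighbourhood no-go -/

/-- **The tree's polar no-go implies the neighbourhood one.** The hypothesis of
`deMichelisFreedman1992_continuum_of_polar_nogo` (p. 247: for `s ≠ t ∈ CS` every
diffeomorphism `R⁴_s ≅ R⁴_t` moves a point of `K`) implies the hypothesis used below (for
`s < t ∈ CS` every diffeomorphism `R⁴_s ≅ R⁴_t` moves a point of every open neighbourhood of
`K`), so the reduction of this file is the stronger one. [cite: DeMichelisFreedman1992, proof of Thm. 4.1, p. 247; §0 (p. 220)] -/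
theorem polarNhdNogo_of_polarNogo {R : Opens (EuclideanSpace ℝ (Fin 4))}
    {e : R ≃ₜ EuclideanSpace ℝ (Fin 4)} {K : Set (EuclideanSpace ℝ (Fin 4))}
    (hno : ∀ s t : cantorSet, s ≠ t →
      ∀ d : polarBall R e (s : ℝ) ≃ₘ⟮𝓡 4, 𝓡 4⟯ polarBall R e (t : ℝ),
        ∃ x : polarBall R e (s : ℝ), (x : EuclideanSpace ℝ (Fin 4)) ∈ K ∧
          ((d x : polarBall R e (t : ℝ)) : EuclideanSpace ℝ (Fin 4)) ≠ x) :
    ∀ s t : cantorSet, s < t →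
      ∀ d : polarBall R e (s : ℝ) ≃ₘ⟮𝓡 4, 𝓡 4⟯ polarBall R e (t : ℝ),
        ∀ W : Set (EuclideanSpace ℝ (Fin 4)), IsOpen W → K ⊆ W →
          ∃ x : polarBall R e (s : ℝ), (x : EuclideanSpace ℝ (Fin 4)) ∈ W ∧
            ((d x : polarBall R e (t : ℝ)) : EuclideanSpace ℝ (Fin 4)) ≠ x := by
  intro s t hst d W _ hKW
  obtain ⟨x, hxK, hx⟩ := hno s t (ne_of_lt hst) d
  exact ⟨x, hKW hxK, hx⟩

/-- **DeMichelis–Freedman 1992, Thm. 4.1 (the `CS`-indexed nested family of open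
`ℝ⁴`-homeomorphs with countable diffeomorphism classes) from the neighbourhood no-go for the
printed polar family.** Given an open `R ⊆ ℝ⁴` with a topological system of polar coordinates
`e : R ≃ₜ ℝ⁴` and a compact `K` inside the unit ball `R⁴_0` of the radial function `‖e ·‖`
(Thm. 3.2: "`K ⊂ R⁴_0`") such that for `s < t` in `CS` no diffeomorphism of the open balls
`R⁴_s ≅ R⁴_t` (`R⁴_t = polarBall R e t`, open subsets of `ℝ⁴` with the smooth structure by
restriction) restricts to the identity on an open neighbourhood of `K` (§0, p. 220; p. 247), the
family `t ↦ R⁴_t`, `t ∈ CS`, is monotone, consists of `ℝ⁴`-homeomorphs, and has countable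
diffeomorphism classes. [cite: DeMichelisFreedman1992, Thm. 4.1 (p. 246) and its proof (p. 247); §0 (p. 220); Thm. 3.2 (p. 244)] -/
theorem deMichelisFreedman1992_countableClasses_of_polar_nhdNogo
    (h : ∃ (R : Opens (EuclideanSpace ℝ (Fin 4))) (e : R ≃ₜ EuclideanSpace ℝ (Fin 4))
      (K : Set (EuclideanSpace ℝ (Fin 4))), IsCompact K ∧ K ⊆ polarBall R e 0 ∧
      ∀ s t : cantorSet, s < t →
        ∀ d : polarBall R e (s : ℝ) ≃ₘ⟮𝓡 4, 𝓡 4⟯ polarBall R e (t : ℝ),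
          ∀ W : Set (EuclideanSpace ℝ (Fin 4)), IsOpen W → K ⊆ W →
            ∃ x : polarBall R e (s : ℝ), (x : EuclideanSpace ℝ (Fin 4)) ∈ W ∧
              ((d x : polarBall R e (t : ℝ)) : EuclideanSpace ℝ (Fin 4)) ≠ x) :
    ∃ R : cantorSet → Opens (EuclideanSpace ℝ (Fin 4)), Monotone R ∧
      (∀ t, Nonempty (R t ≃ₜ EuclideanSpace ℝ (Fin 4))) ∧
      ∀ t, {t' | Nonempty (R t' ≃ₘ⟮𝓡 4, 𝓡 4⟯ R t)}.Countable := by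
  obtain ⟨R, e, K, hK, hK0, hno⟩ := h
  have hKR : ∀ t : cantorSet, K ⊆ polarBall R e (t : ℝ) := fun t =>
    hK0.trans (polarBall_mono R e (cantorSet_subset_unitInterval t.2).1)
  refine ⟨fun t => polarBall R e (t : ℝ), fun s t hst => polarBall_mono R e hst,
    fun t => nonempty_polarBall_homeomorph R e (t : ℝ), fun s => ?_⟩
  exact countable_setOf_nonempty_diffeomorph_of_nhdNogo (fun t : cantorSet => polarBall R e t)
    hK hKR (nhdNogo_of_lt (fun t : cantorSet => polarBall R e t) hKR hno) s

/-- **The tree's fact `deMichelisFreedman1992_continuum` from the neighbourhood no-go for the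
polar family of ONE open `ℝ⁴`-homeomorph `R ⊆ ℝ⁴` with compactum `K ⊂ R⁴_0`** (through
Thm. 4.1, `deMichelisFreedman1992_countableClasses_of_polar_nhdNogo`, and Cor. 4.1,
`deMichelisFreedman1992_continuum_of_countableClasses`). The discharge
`deMichelisFreedman1992_continuum_holds` is this theorem applied to the output `(R, ρ = ‖e ·‖, K)`
of Thms. 3.1, 3.2 for Kotschick's h-cobordism together with the `Φ`-invariant contradiction of
§0/§4 (Thm. 2.1: a diffeomorphism `(R⁴_s, K) → (R⁴_t, K)`, `s < t`, relative to the identity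
on `K` — a fortiori one that is the identity near `K` — would make `B_∞` isometric to `Q_∞` and
force `Φ(B) = Φ(Q)`) — the part of the source that is a theory absent from Mathlib. [cite: DeMichelisFreedman1992, §0 (p. 220); Thm. 4.1, Cor. 4.1 and their proofs (pp. 246–248)] -/
theorem deMichelisFreedman1992_continuum_of_polar_nhdNogo
    (h : ∃ (R : Opens (EuclideanSpace ℝ (Fin 4))) (e : R ≃ₜ EuclideanSpace ℝ (Fin 4))
      (K : Set (EuclideanSpace ℝ (Fin 4))), IsCompact K ∧ K ⊆ polarBall R e 0 ∧
      ∀ s t : cantorSet, s < t →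
        ∀ d : polarBall R e (s : ℝ) ≃ₘ⟮𝓡 4, 𝓡 4⟯ polarBall R e (t : ℝ),
          ∀ W : Set (EuclideanSpace ℝ (Fin 4)), IsOpen W → K ⊆ W →
            ∃ x : polarBall R e (s : ℝ), (x : EuclideanSpace ℝ (Fin 4)) ∈ W ∧
              ((d x : polarBall R e (t : ℝ)) : EuclideanSpace ℝ (Fin 4)) ≠ x) :
    deMichelisFreedman1992_continuum :=
  deMichelisFreedman1992_continuum_of_countableClasses
    (deMichelisFreedman1992_countableClasses_of_polar_nhdNogo h)

/-- The barrier `OpenAnalogueBarrierFour` from the same neighbourhood no-go.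
[cite: DeMichelisFreedman1992, Thm. 4.1 and Cor. 4.1] -/
theorem openAnalogueBarrierFour_of_polar_nhdNogo
    (h : ∃ (R : Opens (EuclideanSpace ℝ (Fin 4))) (e : R ≃ₜ EuclideanSpace ℝ (Fin 4))
      (K : Set (EuclideanSpace ℝ (Fin 4))), IsCompact K ∧ K ⊆ polarBall R e 0 ∧
      ∀ s t : cantorSet, s < t →
        ∀ d : polarBall R e (s : ℝ) ≃ₘ⟮𝓡 4, 𝓡 4⟯ polarBall R e (t : ℝ),
          ∀ W : Set (EuclideanSpace ℝ (Fin 4)), IsOpen W → K ⊆ W →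
            ∃ x : polarBall R e (s : ℝ), (x : EuclideanSpace ℝ (Fin 4)) ∈ W ∧
              ((d x : polarBall R e (t : ℝ)) : EuclideanSpace ℝ (Fin 4)) ≠ x) :
    OpenAnalogueBarrierFour :=
  openAnalogueBarrierFour_of_deMichelisFreedman
    (deMichelisFreedman1992_continuum_of_polar_nhdNogo h)

end Literature.Barriers.SmoothPoincare4

end
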